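import Mathlib
import Summits.Ventures.HodgeRepro2.T5EmbeddingPrimeEquiv
import Summits.Ventures.HodgeRepro2.T5OrdinaryCMType

/-!
# T5EmbeddingTorsor — for a Galois `E/ℚ`, `Hom(E, ℚ_p)` is a `Gal(E/ℚ)`-torsor, and the place
induced by `ι ∘ σ` is the pull-back of the place induced by `ι`

Tier-5 support (seat p7, cell pub-hodge-repro2), third file of the embedding chain, for
route/T5-CHECK-G-p7.md §12.2 row P1.5 and CHECK-G S0 («p splits completely ⇒ every CM type is
p-ordinary»).  Row 32 (`T5OrdinaryCMType`) proved the (ord) sentence in the GALOIS-GROUP dialect —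
the elements of a CM type read as `σ ∈ Gal(E/ℚ)`, «the place induced by ι_p ∘ σ» read as
`σ⁻¹ • P`.  This file supplies the dictionary between that dialect and actual embeddings
`E →+* ℚ_[p]`, given ONE embedding `ι` (the print's `ι_p` restricted to `E`):

* `compGal ι σ = ι ∘ σ` is injective, and bijective onto `E →+* ℚ_[p]` by counting
  (`card_ringHom` = `[E : ℚ]` from `T5EmbeddingPrimeEquiv`, `IsGalois.card_aut_eq_finrank`):
  `galEquivRingHom ι : Gal(E/ℚ) ≃ (E →+* ℚ_[p])`;
* `inducedPrime_compGal`: the prime induced by `ι ∘ σ` is `comap (galRestrict σ)` of the prime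
  induced by `ι` — i.e. row 32's `σ⁻¹ • P` (`inducedPrime_compGal_eq_dialect`);
* `isOrdinary`: for `T ⊆ Gal(E/ℚ)` with `T ∩ cT = ∅`, `T ∪ cT = Gal(E/ℚ)` (a CM type and its
  conjugate), the places induced by `ι ∘ σ`, `σ ∈ T`, are disjoint from those induced by
  `σ ∈ cT`, and together they are ALL the primes above `p` — Hsieh's (ord) for the datum, with
  the embeddings as actual ring homomorphisms into `ℚ_p`.

What stays prose: that the print's `ι_p : ℚ̄ → ℂ_p` restricted to `σ(E)` lands in `ℚ_p` (it does,
since `p` splits completely) and that the CM type of print is a set of embeddings `E → ℂ`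
identified with `Gal(E/ℚ)` through one embedding — the reading «ι_p ∘ σ ↦ compGal ι σ».
-/

namespace Summit.Ventures.HodgeRepro2.T5EmbeddingTorsor

open IsDedekindDomain NumberField T5DegreeOneEmbeddings T5EmbeddingPrimeEquiv
open scoped Pointwise

variable {E : Type*} [Field E] [NumberField E] {p : ℕ} [hp : Fact p.Prime]

/-- `E →+* ℚ_[p]` is finite (it is `E →ₐ[ℚ] ℚ_[p]`, finite by linear independence of
characters). -/
instance finite_ringHom : Finite (E →+* ℚ_[p]) :=
  Finite.of_equiv _ (RingHom.equivRatAlgHom (R := E) (S := ℚ_[p])).symm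

variable (ι : E →+* ℚ_[p])

/-- `σ ↦ ι ∘ σ`. -/
noncomputable def compGal (σ : E ≃ₐ[ℚ] E) : E →+* ℚ_[p] := ι.comp σ.toAlgHom.toRingHom

/-- `compGal ι σ x = ι (σ x)`. -/
@[simp]
theorem compGal_apply (σ : E ≃ₐ[ℚ] E) (x : E) : compGal ι σ x = ι (σ x) := rfl

/-- `σ ↦ ι ∘ σ` is injective. -/
theorem compGal_injective : Function.Injective (compGal ι) := by
  intro σ τ h
  ext x
  exact ι.injective (RingHom.congr_fun h x)

section galois

variable [IsGalois ℚ E]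

include ι in
/-- `E/ℚ` Galois with one embedding into `ℚ_p` ⇒ `#Hom(E, ℚ_p) = [E : ℚ]` (the prime induced by
`ι` has degree one, and `E/ℚ` is Galois). -/
theorem card_ringHom : Nat.card (E →+* ℚ_[p]) = Module.finrank ℚ E :=
  card_ringHom_eq_finrank_of_isGalois E p (inducedPrime ι) (degree_one_inducedPrime ι)

/-- `σ ↦ ι ∘ σ` is a bijection `Gal(E/ℚ) → Hom(E, ℚ_p)`: `Hom(E, ℚ_p)` is a torsor. -/
theorem compGal_bijective : Function.Bijective (compGal ι) :=
  (compGal_injective ι).bijective_of_nat_card_le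
    (by rw [card_ringHom ι, IsGalois.card_aut_eq_finrank])

/-- Every embedding `E → ℚ_p` is `ι ∘ σ` for a unique `σ ∈ Gal(E/ℚ)`. -/
theorem exists_compGal_eq (φ : E →+* ℚ_[p]) : ∃ σ : E ≃ₐ[ℚ] E, compGal ι σ = φ :=
  (compGal_bijective ι).2 φ

/-- The torsor structure: `Gal(E/ℚ) ≃ Hom(E, ℚ_p)`, `σ ↦ ι ∘ σ`. -/
noncomputable def galEquivRingHom : (E ≃ₐ[ℚ] E) ≃ (E →+* ℚ_[p]) :=
  Equiv.ofBijective _ (compGal_bijective ι)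

/-- `galEquivRingHom ι σ = ι ∘ σ`. -/
theorem galEquivRingHom_apply (σ : E ≃ₐ[ℚ] E) : galEquivRingHom ι σ = compGal ι σ := rfl

end galois

/-- The prime induced by `ι ∘ σ` is the pull-back along `σ|_{𝓞 E}` (Mathlib's `galRestrict`) of
the prime induced by `ι`. -/
theorem inducedPrime_compGal (σ : E ≃ₐ[ℚ] E) :
    (inducedPrime (compGal ι σ)).asIdeal =
      (inducedPrime ι).asIdeal.comap (galRestrict ℤ ℚ E (𝓞 E) σ) := by
  ext x
  rw [mem_inducedPrime_iff, Ideal.mem_comap, mem_inducedPrime_iff, compGal_apply,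
    algebraMap_galRestrict_apply]

/-- The dialect bridge to row 32 (`T5OrdinaryCMType`): the prime induced by `ι ∘ σ` is
`(galRestrict σ)⁻¹ • P` for `P` the prime induced by `ι`, in the pointwise action of
`𝓞 E ≃ₐ[ℤ] 𝓞 E` on the ideals of `𝓞 E`. -/
theorem inducedPrime_compGal_eq_dialect (σ : E ≃ₐ[ℚ] E) :
    (inducedPrime (compGal ι σ)).asIdeal =
      T5OrdinaryCMType.inducedPrime (inducedPrime ι).asIdeal (galRestrict ℤ ℚ E (𝓞 E) σ) := by
  rw [T5OrdinaryCMType.inducedPrime_apply, Ideal.pointwise_smul_eq_comap, inducedPrime_compGal]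
  ext x
  simp only [Ideal.mem_comap]
  rfl

/-- The set of places induced by `ι ∘ σ`, `σ ∈ T` («Σ_p» for a set `T` of Galois elements). -/
def places (T : Set (E ≃ₐ[ℚ] E)) : Set (HeightOneSpectrum (𝓞 E)) :=
  (fun σ => inducedPrime (compGal ι σ)) '' T

/-- `places ι T` is the image of `T`. -/
theorem mem_places_iff (T : Set (E ≃ₐ[ℚ] E)) (w : HeightOneSpectrum (𝓞 E)) :
    w ∈ places ι T ↔ ∃ σ ∈ T, inducedPrime (compGal ι σ) = w := Iff.rfl

/-- Disjoint sets of Galois elements induce disjoint sets of places (first half of (ord)). -/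
theorem disjoint_places {T T' : Set (E ≃ₐ[ℚ] E)} (h : Disjoint T T') :
    Disjoint (places ι T) (places ι T') :=
  (Set.disjoint_image_iff (inducedPrime_injective.comp (compGal_injective ι))).mpr h

/-- Every induced place lies over `p`. -/
theorem places_subset (T : Set (E ≃ₐ[ℚ] E)) :
    places ι T ⊆ {w : HeightOneSpectrum (𝓞 E) | w.asIdeal.LiesOver (Ideal.span {(p : ℤ)})} := by
  rintro w ⟨σ, -, rfl⟩
  exact inducedPrime_liesOver _

section galois

variable [IsGalois ℚ E]

/-- Sets of Galois elements covering `Gal(E/ℚ)` induce ALL the places above `p` (second half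
of (ord); uses that every prime above `p` has degree one, row 12, and the torsor structure). -/
theorem places_union_eq_of_union_eq_univ {T T' : Set (E ≃ₐ[ℚ] E)} (h : T ∪ T' = Set.univ) :
    places ι T ∪ places ι T' =
      {w : HeightOneSpectrum (𝓞 E) | w.asIdeal.LiesOver (Ideal.span {(p : ℤ)})} := by
  apply Set.Subset.antisymm
  · exact Set.union_subset (places_subset ι T) (places_subset ι T')
  · intro w hw
    haveI : w.asIdeal.LiesOver (Ideal.span {(p : ℤ)}) := hw
    have hdeg : w.asIdeal.ramificationIdx ℤ * w.asIdeal.inertiaDeg ℤ = 1 :=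
      forall_degree_one_of_isGalois E p (inducedPrime ι) (degree_one_inducedPrime ι) w hw
    obtain ⟨σ, hσ⟩ := exists_compGal_eq ι (embedding w p hdeg)
    have hwσ : inducedPrime (compGal ι σ) = w := by
      rw [hσ]; exact inducedPrime_embedding w hdeg
    have hmem : σ ∈ T ∪ T' := by rw [h]; exact Set.mem_univ σ
    rcases hmem with hσT | hσT'
    · exact Or.inl ⟨σ, hσT, hwσ⟩
    · exact Or.inr ⟨σ, hσT', hwσ⟩

/-- **(ord) in embedding vocabulary**: for `c ∈ Gal(E/ℚ)` and `T ⊆ Gal(E/ℚ)` with `T ∩ cT = ∅`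
and `T ∪ cT = Gal(E/ℚ)` (a CM type `Σ` and its conjugate `Σc`, read through `ι`), the places
induced by `ι ∘ σ` for `σ ∈ Σ` are disjoint from those induced by `σ ∈ Σc`, and together they
are all the primes above `p`. -/
theorem isOrdinary (c : E ≃ₐ[ℚ] E) {T : Set (E ≃ₐ[ℚ] E)} (hdisj : Disjoint T (c • T))
    (hcover : T ∪ c • T = Set.univ) :
    Disjoint (places ι T) (places ι (c • T)) ∧
      places ι T ∪ places ι (c • T) =
        {w : HeightOneSpectrum (𝓞 E) | w.asIdeal.LiesOver (Ideal.span {(p : ℤ)})} :=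
  ⟨disjoint_places ι hdisj, places_union_eq_of_union_eq_univ ι hcover⟩

end galois

end Summit.Ventures.HodgeRepro2.T5EmbeddingTorsor
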